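import Summits.ResolutionOfSingularities.ResolutionOfSingularities.Theorems.FrobeniusLadderFInjectiveMacaulayficationLocalDoorYardstick
import Summits.ResolutionOfSingularities.ResolutionOfSingularities.Theorems.FrobeniusLadderFInjectiveMacaulayficationLocalFullificationFibreAdmGe4
import Summits.ResolutionOfSingularities.ResolutionOfSingularities.Theorems.FrobeniusLadderFInjectiveMacaulayficationRegularOffFiniteOfLRAdm
import HarnessLib

/-!
# THE YARDSTICK CERTIFICATE OF DOOR v36.2 «AD» IN THE KERNEL: local resolution (Temkin 2008, Prop. 2.3.4 (iii)) ⇒ (LR_adm) ∧ (LF_adm)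
# (crux `FInjectiveMacaulayfication` stmt-ResolutionOfSingularities-15315, chain w45a; res-L1-w45a-plan-1 RULING R17.8 (AD5): «the two `_of_localRes` lines for the
# AD defs» — §4 of this seat's `LocalDoorYardstick` (p589757), filed as a companion file; seat res-L1-w45a-stub-2 g6)

[OURS · L1 W4.5a] Support file (`--supports stmt-ResolutionOfSingularities-15315 --as helper`); replaces the role of NO printed item; NOT a statement of
the manuscript; def-free; AI-written (AI review is weaker than expert review).

S_loc := `∀ k, Literature.AlgebraicGeometry.Resolution.LocalBlowupsAdmitDesingularization (Spec k)` (Temkin 2.3.4 (iii), as typed in the tree).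
* `localFullificationFibreAdmGe4_of_localRes : S_loc → (LF_adm)` — through `LocalDoorYardstick.localFullificationFibreClosedGe4_of_localRes` and the weakening
  `LocalFullificationFibreAdmGe4.localFullificationFibreAdmGe4_of_closedGe4`;
* `localResolutionNonClosedGe4Adm_of_localRes : S_loc → (LR_adm)` — through `LocalDoorYardstick.localResolutionNonClosedGe4Fibre_of_localRes` and res-L1-w45a-stub-3's
  weakening `RegularOffFiniteOfLRAdm.localResolutionNonClosedGe4Adm_of_fibre`;
So v36.2's registered pair {(LR_adm), (LF_adm)} is ≤ S_loc STUB BY STUB as a kernel statement (the FULL blow-up model modulo S_loc is already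
`LocalDoorYardstick.exists_isBlowup_full_of_localRes`, not restated).
[folklore assembly; cite: Temkin2008, Prop. 2.3.4 (iii) and Def. 2.2.6]
-/

-- single-problem summit: the doubled namespace component is forced
set_option linter.dupNamespace false

noncomputable section

namespace Summit.ResolutionOfSingularities.ResolutionOfSingularities.Theorems.FInjectiveMacaulayfication.LocalDoorYardstickAdm

open CategoryTheory CategoryTheory.Limits AlgebraicGeometry TopologicalSpace IsLocalRing
open Literature.AlgebraicGeometry.Resolution
open Summit.ResolutionOfSingularities.ResolutionOfSingularities.Theorems.FInjectiveMacaulayfication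
open SliceableCentre

/-- **S_loc ⇒ (LF_adm)** (the F-side stub of v36.2). [folklore; cite: Temkin2008, Prop. 2.3.4 (iii)] -/
theorem localFullificationFibreAdmGe4_of_localRes
    (hT : ∀ (k : Type) [Field k], LocalBlowupsAdmitDesingularization (Spec (.of k))) :
    LocalFullificationFibreAdmGe4.LocalFullificationFibreAdmGe4 :=
  LocalFullificationFibreAdmGe4.localFullificationFibreAdmGe4_of_closedGe4
    (LocalDoorYardstick.localFullificationFibreClosedGe4_of_localRes hT)

/-- **S_loc ⇒ (LR_adm)** (the resolution-side stub of v36.2). [folklore; cite: Temkin2008, Prop. 2.3.4 (iii)] -/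
theorem localResolutionNonClosedGe4Adm_of_localRes
    (hT : ∀ (k : Type) [Field k], LocalBlowupsAdmitDesingularization (Spec (.of k))) :
    RegularOffFiniteOfLRAdm.LocalResolutionNonClosedGe4Adm :=
  RegularOffFiniteOfLRAdm.localResolutionNonClosedGe4Adm_of_fibre
    (LocalDoorYardstick.localResolutionNonClosedGe4Fibre_of_localRes hT)

end Summit.ResolutionOfSingularities.ResolutionOfSingularities.Theorems.FInjectiveMacaulayfication.LocalDoorYardstickAdm

end
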